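import Summits.AtomisticToContinuum.HydrodynamicLimit.Theorems.RelayRaceLocalityLightConeInLawExtensiveTransferTools
import Summits.AtomisticToContinuum.HydrodynamicLimit.Theorems.JParityClosureOddContactSymmetryGibbsInvariance
import HarnessLib

/-!
# L1 — Extensive transfer along the flow (crux `LightConeInLaw`, stmt-AtomisticToContinuum-12500)

Support file (`--supports stmt-AtomisticToContinuum-12500`, route `RelayRaceLocality`, sub-problem
`HydrodynamicLimit`; lead c7, line `count-sufficiency-reduction`). It proves, BY ITS TYPED STATEMENT, the
lemma L1 `ExtensiveTransferAlongFlow` of the r2 crux cards `virgin-front-energy-budget` ≈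
`clean-territory-island` (typed as `VirginFront.ExtensiveTransferAlongFlow` in
`Cruxes/LightConeInLaw/IdeatorFourSketch.lean`, graded "provable now" by triage r2): for every guard level
`M` and homogeneous reference `(a, 0, θ)` there is `h ≥ 0` such that for all continuous profiles obeying the
consumer's guards `M⁻¹ ≤ a₁ ≤ M`, `M⁻¹ ≤ θ₁ ≤ M`, `‖u₁‖ ≤ M`, all `0 < σ < 1/2`, all hard-sphere flows,
every `K > h` and every family of measurable events `A_N` with `G_N(A_N) ≤ e^{-K(N+1)}` under the
homogeneous Gibbs law `G_N = localGibbsLaw σ a 0 θ N`, the TRUE non-equilibrium law at ARBITRARY times `s_N`,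
`(Φ_{s_N})_* localGibbsLaw σ a₁ u₁ θ₁ N`, gives `A_N` probability `→ 0`.

## Proof

Everything is static. `lawAt` is the push-forward, so `P_s(A) = P₀(Φ_s⁻¹ A)`, and the homogeneous law is
invariant (`map_flow_localGibbsLaw_const`), so `G(Φ_s⁻¹ A) = G(A)`; the activity `a` is immaterial
(`localGibbsMeasure_const_activity`). The static input is a POWER budget
`P₀(S)^n ≤ e^{h(N+1)} G_θ(S)` valid uniformly over guarded profiles and over `σ < 1/2`
(`guarded_pow_le_exp_mul`): one guard-uniform `L²` budget against the homogeneous law at a temperature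
`θ(3/2)^m > M/2` (`LightConeInLawTransfer.localGibbsMeasure_sq_le_exp_mul_unif`, tools file) followed by the
temperature-LOWERING chain `G_{θ(3/2)^{k+1}}(S)² ≤ e^{C_k(N+1)} G_{θ(3/2)^k}(S)` (`homogeneous_chain`; the
density ratio of a hot homogeneous law against a cold one is unbounded but square integable as soon as the
temperature ratio is `< 2`), `n = 2^{m+1}`. Then `P₀(S)^n ≤ e^{(h−K)(N+1)} = (e^{-(K−h)(N+1)/n})^n` gives
`P_{s_N}(A_N) ≤ e^{-(K−h)(N+1)/n} → 0`. No entropy inequality, no law of large numbers and no locality is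
used (consistent with `Cruxes/LightConeInLaw/Disproof.lean` §5: the lemma holds for every diameter).

What it is for: the transfer step of every "equilibrium-reference" argument along the true law at
macroscopic times (the r2 island card's `HotFluxBound`/`KickChernoff` residuals, the route's M2 step, the
restart class of `RestartPrinciple`): an event priced `e^{-K(N+1)}` under a homogeneous Gibbs law with `K`
above the explicit `h(M, θ)` is negligible under the evolved local Gibbs law, whatever the time.
It does NOT transfer `e^{-cN^{1/3}}`-rare (cone-type) events — the known obstruction of the route.

References: C. Kipnis, C. Landim, *Scaling Limits of Interacting Particle Systems* (1999), App. 1 §8;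
H.-T. Yau, Lett. Math. Phys. 22 (1991) §2; H. Spohn, *Large Scale Dynamics of Interacting Particles*
(1991), Part I §2.3.
-/

noncomputable section

open MeasureTheory Set Filter Topology
open scoped ENNReal

namespace Summit.AtomisticToContinuum.HydrodynamicLimit.Theorems

namespace LightConeInLawTransfer

open Literature.Analysis.FluidPDE Literature.MathematicalPhysics.KineticTheory
open TransferBudget

/-! ### Constant activities do not change a canonical law -/

/-- A constant factor of the one-body weight cancels against the canonical partition function (if the
latter vanishes both sides are the junk `0`), so the canonical density does not see it. [folklore] -/
theorem canonicalDensity_const_mul' {n : ℕ} {lam : ℝ} (hlam : lam ≠ 0) (ε : ℝ) (f : T3 × V3 → ℝ) :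
    canonicalDensity (Torus.geometry (Fin 3)) ε n (fun y => lam * f y) =
      canonicalDensity (Torus.geometry (Fin 3)) ε n f := by
  funext z
  set D := hardSphereDomain (Torus.geometry (Fin 3)) n ε with hD
  have htp : tensorPow n (fun y => lam * f y) =
      fun z : Config n (Fin 3) T3 => lam ^ n * tensorPow n f z := by
    funext w
    simp [tensorPow, Finset.prod_mul_distrib, Finset.prod_const]
  have hind : D.indicator (tensorPow n (fun y => lam * f y)) =
      fun z => lam ^ n * D.indicator (tensorPow n f) z := by
    funext w
    rw [htp]
    by_cases hw : w ∈ D <;> simp [hw]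
  have hZ : canonicalPartition (Torus.geometry (Fin 3)) ε n (fun y => lam * f y) =
      lam ^ n * canonicalPartition (Torus.geometry (Fin 3)) ε n f := by
    simp only [canonicalPartition, ← hD, hind]
    exact integral_const_mul _ _
  have han : (lam ^ n)⁻¹ * lam ^ n = 1 := inv_mul_cancel₀ (pow_ne_zero n hlam)
  simp only [canonicalDensity, ← hD, hZ, hind]
  calc (lam ^ n * canonicalPartition (Torus.geometry (Fin 3)) ε n f)⁻¹ *
        (lam ^ n * D.indicator (tensorPow n f) z)
      = ((lam ^ n)⁻¹ * lam ^ n) * ((canonicalPartition (Torus.geometry (Fin 3)) ε n f)⁻¹ *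
          D.indicator (tensorPow n f) z) := by rw [mul_inv]; ring
    _ = _ := by rw [han, one_mul]

/-- The homogeneous local Gibbs measure does not depend on its (constant, nonzero) activity:
`localGibbsMeasure σ a u θ N = localGibbsMeasure σ 1 u θ N`. [folklore] -/
theorem localGibbsMeasure_const_activity {a : ℝ} (ha : a ≠ 0) (σ θ : ℝ) (u : V3) (N : ℕ) :
    localGibbsMeasure σ (fun _ => a) (fun _ => u) (fun _ => θ) N =
      localGibbsMeasure σ (fun _ => 1) (fun _ => u) (fun _ => θ) N := by
  have hprof : localGibbsProfile (fun _ => a) (fun _ => u) (fun _ => θ) =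
      fun y => a * localGibbsProfile (fun _ => 1) (fun _ => u) (fun _ => θ) y := by
    funext y
    simp [localGibbsProfile]
  unfold localGibbsMeasure
  rw [hprof, canonicalDensity_const_mul' ha]

/-! ### The temperature-lowering chain for homogeneous laws -/

/-- Bookkeeping of the exponential constants: `(e^{C₁(N+1)})^{k} · e^{C(N+1)} = e^{(C₁k + C)(N+1)}` in
`ℝ≥0∞`. [folklore] -/
theorem ofReal_exp_pow_mul_ofReal_exp (C₁ C : ℝ) (k N : ℕ) :
    ENNReal.ofReal (Real.exp (C₁ * (N + 1))) ^ k * ENNReal.ofReal (Real.exp (C * (N + 1))) =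
      ENNReal.ofReal (Real.exp ((C₁ * k + C) * (N + 1))) := by
  rw [← ENNReal.ofReal_pow (Real.exp_nonneg _), ← Real.exp_nat_mul,
    ← ENNReal.ofReal_mul (Real.exp_nonneg _), ← Real.exp_add]
  congr 2
  ring

/-- **The temperature-lowering chain.** For `θ > 0` and every `m`, with `θ_m = θ (3/2)^m`, there is
`C ≥ 0` such that for all `0 < σ < 1/2`, all `N` and every set `S`,
`G_{θ_m}(S)^{2^m} ≤ e^{C(N+1)} · G_θ(S)` for the homogeneous Gibbs laws `G_ϑ = localGibbsMeasure σ 1 0 ϑ N`: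
`m` applications of the static `L²` budget between consecutive homogeneous laws (`θ_{k+1} < 2 θ_k`).
This is how an event that is exponentially rare under a COLD homogeneous law is shown to be
exponentially rare under a hotter one (the density ratio is unbounded, but square integrable).
[cite: KipnisLandim1999, App. 1 §8] -/
theorem homogeneous_chain {θ : ℝ} (hθ : 0 < θ) (m : ℕ) :
    ∃ C : ℝ, 0 ≤ C ∧ ∀ {σ : ℝ}, 0 < σ → σ < 1 / 2 → ∀ (N : ℕ) (S : Set (Config (N + 1) (Fin 3) T3)),
      localGibbsMeasure σ (fun _ => 1) (fun _ => (0 : V3)) (fun _ => θ * (3 / 2) ^ m) N S ^ (2 ^ m) ≤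
        ENNReal.ofReal (Real.exp (C * (N + 1))) *
          localGibbsMeasure σ (fun _ => 1) (fun _ => (0 : V3)) (fun _ => θ) N S := by
  induction m with
  | zero =>
      refine ⟨0, le_rfl, @fun σ hσ0 hσ N S => ?_⟩
      simp
  | succ m ih =>
      obtain ⟨C, hC0, hC⟩ := ih
      have hθm : 0 < θ * (3 / 2) ^ m := by positivity
      have hθm1 : 0 < θ * (3 / 2) ^ (m + 1) := by positivity
      have hlt : θ * (3 / 2) ^ (m + 1) < 2 * (θ * (3 / 2) ^ m) := by
        rw [pow_succ]
        nlinarith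
      obtain ⟨C₁, hC₁0, hC₁⟩ :=
        localGibbsMeasure_sq_le_exp_mul_unif (A := 1) (U := 0) one_pos hθm1 hθm1 hθm hlt
      refine ⟨C₁ * 2 ^ m + C, by positivity, @fun σ hσ0 hσ N S => ?_⟩
      have h1 := hC₁ (fun _ => 1) (fun _ => θ * (3 / 2) ^ (m + 1)) (fun _ => (0 : V3))
        continuous_const continuous_const continuous_const (fun _ => le_rfl) (fun _ => le_rfl)
        (fun _ => le_rfl) (fun _ => le_rfl) (fun _ => by simp) hσ0 hσ N S
      have h2 := hC hσ0 hσ N S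
      calc localGibbsMeasure σ (fun _ => 1) (fun _ => (0 : V3)) (fun _ => θ * (3 / 2) ^ (m + 1)) N S ^
            (2 ^ (m + 1))
          = (localGibbsMeasure σ (fun _ => 1) (fun _ => (0 : V3)) (fun _ => θ * (3 / 2) ^ (m + 1)) N S ^
              2) ^ (2 ^ m) := by rw [pow_succ' (2 : ℕ) m, pow_mul]
        _ ≤ (ENNReal.ofReal (Real.exp (C₁ * (N + 1))) *
              localGibbsMeasure σ (fun _ => 1) (fun _ => (0 : V3)) (fun _ => θ * (3 / 2) ^ m) N S) ^
              (2 ^ m) := by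
            gcongr
        _ = ENNReal.ofReal (Real.exp (C₁ * (N + 1))) ^ (2 ^ m) *
              localGibbsMeasure σ (fun _ => 1) (fun _ => (0 : V3)) (fun _ => θ * (3 / 2) ^ m) N S ^
                (2 ^ m) := mul_pow _ _ _
        _ ≤ ENNReal.ofReal (Real.exp (C₁ * (N + 1))) ^ (2 ^ m) *
              (ENNReal.ofReal (Real.exp (C * (N + 1))) *
                localGibbsMeasure σ (fun _ => 1) (fun _ => (0 : V3)) (fun _ => θ) N S) := by
            gcongr
        _ = ENNReal.ofReal (Real.exp ((C₁ * 2 ^ m + C) * (N + 1))) *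
              localGibbsMeasure σ (fun _ => 1) (fun _ => (0 : V3)) (fun _ => θ) N S := by
            rw [← mul_assoc, ofReal_exp_pow_mul_ofReal_exp C₁ C (2 ^ m) N]
            simp only [Nat.cast_pow, Nat.cast_ofNat]

/-! ### A guarded local Gibbs law against a homogeneous law at ANY temperature -/

/-- **Guard-uniform power budget.** For a guard level `M > 0` and a reference temperature `θ > 0` there
are an exponent `n ≥ 1` and `h ≥ 0` such that for EVERY continuous profile obeying the guards
`M⁻¹ ≤ a₁ ≤ M`, `M⁻¹ ≤ θ₁ ≤ M`, `‖u₁‖ ≤ M`, all `0 < σ < 1/2`, all `N` and every set `S`,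
`localGibbsMeasure σ a₁ u₁ θ₁ N S ^ n ≤ e^{h(N+1)} · localGibbsMeasure σ 1 0 θ N S`: one static `L²`
budget against the homogeneous law at a temperature `θ(3/2)^m > M/2` (`localGibbsMeasure_sq_le_exp_mul_unif`)
followed by the temperature-lowering chain (`homogeneous_chain`); `n = 2^{m+1}`.
[cite: KipnisLandim1999, App. 1 §8] -/
theorem guarded_pow_le_exp_mul {M θ : ℝ} (hM : 0 < M) (hθ : 0 < θ) :
    ∃ (n : ℕ) (h : ℝ), 0 < n ∧ 0 ≤ h ∧ ∀ (a₁ θ₁ : T3 → ℝ) (u₁ : T3 → V3), Continuous a₁ →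
      Continuous θ₁ → Continuous u₁ →
      (∀ x, M⁻¹ ≤ a₁ x ∧ a₁ x ≤ M ∧ M⁻¹ ≤ θ₁ x ∧ θ₁ x ≤ M ∧ ‖u₁ x‖ ≤ M) →
      ∀ {σ : ℝ}, 0 < σ → σ < 1 / 2 → ∀ (N : ℕ) (S : Set (Config (N + 1) (Fin 3) T3)),
      localGibbsMeasure σ a₁ u₁ θ₁ N S ^ n ≤
        ENNReal.ofReal (Real.exp (h * (N + 1))) *
          localGibbsMeasure σ (fun _ => 1) (fun _ => (0 : V3)) (fun _ => θ) N S := by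
  obtain ⟨m, hm⟩ := pow_unbounded_of_one_lt (M / θ) (by norm_num : (1 : ℝ) < 3 / 2)
  have hθm : 0 < θ * (3 / 2) ^ m := by positivity
  have hlt : M < 2 * (θ * (3 / 2) ^ m) := by
    have h1 : M < θ * (3 / 2) ^ m := by
      rw [div_lt_iff₀ hθ] at hm
      linarith
    linarith
  obtain ⟨C₀, hC₀0, hC₀⟩ :=
    localGibbsMeasure_sq_le_exp_mul_unif (A := M) (U := M) (inv_pos.2 hM) (inv_pos.2 hM) hM hθm hlt
  obtain ⟨C, hC0, hC⟩ := homogeneous_chain hθ m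
  refine ⟨2 ^ (m + 1), C₀ * 2 ^ m + C, by positivity, by positivity, ?_⟩
  intro a₁ θ₁ u₁ ha hθ₁ hu hg σ hσ0 hσ N S
  have h1 := hC₀ a₁ θ₁ u₁ ha hθ₁ hu (fun x => (hg x).1) (fun x => (hg x).2.1) (fun x => (hg x).2.2.1)
    (fun x => (hg x).2.2.2.1) (fun x => (hg x).2.2.2.2) hσ0 hσ N S
  have h2 := hC hσ0 hσ N S
  calc localGibbsMeasure σ a₁ u₁ θ₁ N S ^ (2 ^ (m + 1))
      = (localGibbsMeasure σ a₁ u₁ θ₁ N S ^ 2) ^ (2 ^ m) := by rw [pow_succ' (2 : ℕ) m, pow_mul]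
    _ ≤ (ENNReal.ofReal (Real.exp (C₀ * (N + 1))) *
          localGibbsMeasure σ (fun _ => 1) (fun _ => (0 : V3)) (fun _ => θ * (3 / 2) ^ m) N S) ^
          (2 ^ m) := by
        gcongr
    _ = ENNReal.ofReal (Real.exp (C₀ * (N + 1))) ^ (2 ^ m) *
          localGibbsMeasure σ (fun _ => 1) (fun _ => (0 : V3)) (fun _ => θ * (3 / 2) ^ m) N S ^
            (2 ^ m) := mul_pow _ _ _
    _ ≤ ENNReal.ofReal (Real.exp (C₀ * (N + 1))) ^ (2 ^ m) *
          (ENNReal.ofReal (Real.exp (C * (N + 1))) *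
            localGibbsMeasure σ (fun _ => 1) (fun _ => (0 : V3)) (fun _ => θ) N S) := by
        gcongr
    _ = ENNReal.ofReal (Real.exp ((C₀ * 2 ^ m + C) * (N + 1))) *
          localGibbsMeasure σ (fun _ => 1) (fun _ => (0 : V3)) (fun _ => θ) N S := by
        rw [← mul_assoc, ofReal_exp_pow_mul_ofReal_exp C₀ C (2 ^ m) N]
        simp only [Nat.cast_pow, Nat.cast_ofNat]

/-! ### The transfer at positive times: quantitative form -/

/-- **Quantitative transfer along the flow.** For a guard level `M > 0` and a reference temperature
`θ > 0` there are `n ≥ 1` and `h ≥ 0` such that for every continuous guarded profile, every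
`0 < σ < 1/2`, every nonzero reference activity `a`, every hard-sphere flow `Φ`, every time `s` and every
measurable event `A`,
`((Φ_s)_* localGibbsLaw σ a₁ u₁ θ₁ N)(A) ^ n ≤ e^{h(N+1)} · localGibbsLaw σ a 0 θ N Φ (A)`:
the law at time `s` is the push-forward (`lawAt`), the homogeneous law is flow invariant
(`map_flow_localGibbsLaw_const`) and does not see the constant activity
(`localGibbsMeasure_const_activity`), and at time `0` this is `guarded_pow_le_exp_mul`. This is the form
consumed by union bounds over polynomially many events (pairs × time grids). [cite: KipnisLandim1999, App. 1 §8] -/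
theorem lawAt_pow_le_exp_mul_gibbs {M θ : ℝ} (hM : 0 < M) (hθ : 0 < θ) :
    ∃ (n : ℕ) (h : ℝ), 0 < n ∧ 0 ≤ h ∧ ∀ (a₁ θ₁ : T3 → ℝ) (u₁ : T3 → V3), Continuous a₁ →
      Continuous θ₁ → Continuous u₁ →
      (∀ x, M⁻¹ ≤ a₁ x ∧ a₁ x ≤ M ∧ M⁻¹ ≤ θ₁ x ∧ θ₁ x ≤ M ∧ ‖u₁ x‖ ≤ M) →
      ∀ {σ : ℝ}, 0 < σ → σ < 1 / 2 → ∀ {a : ℝ}, a ≠ 0 → ∀ (N : ℕ)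
      (Φ : HardSphereFlow (Torus.geometry (Fin 3)) (hsDiameter σ N) (N + 1)) (s : ℝ)
      (A : Set (Config (N + 1) (Fin 3) T3)), MeasurableSet A →
      (Φ.lawAt (localGibbsLaw σ a₁ u₁ θ₁ N Φ) s) A ^ n ≤
        ENNReal.ofReal (Real.exp (h * (N + 1))) *
          localGibbsLaw σ (fun _ => a) (fun _ => 0) (fun _ => θ) N Φ A := by
  obtain ⟨n, h, hn, hh, hpow⟩ := guarded_pow_le_exp_mul hM hθ
  refine ⟨n, h, hn, hh, ?_⟩
  intro a₁ θ₁ u₁ ha₁ hθ₁ hu₁ hguard σ hσ0 hσ a ha N Φ s A hAm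
  set S : Set (Config (N + 1) (Fin 3) T3) := Φ.flow s ⁻¹' A with hS
  have hlaw : (Φ.lawAt (localGibbsLaw σ a₁ u₁ θ₁ N Φ) s) A = localGibbsMeasure σ a₁ u₁ θ₁ N S := by
    rw [HardSphereFlow.lawAt_eq, Measure.map_apply (Φ.measurable_flow _) hAm, localGibbsLaw_eq]
  have hGS : localGibbsMeasure σ (fun _ => 1) (fun _ => (0 : V3)) (fun _ => θ) N S =
      localGibbsLaw σ (fun _ => a) (fun _ => 0) (fun _ => θ) N Φ A := by
    have hinv := map_flow_localGibbsLaw_const σ a θ 0 N Φ s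
    rw [← localGibbsMeasure_const_activity ha σ θ 0 N, ← localGibbsLaw_eq _ _ _ _ _ Φ, hS,
      ← Measure.map_apply (Φ.measurable_flow _) hAm, hinv]
  rw [hlaw, ← hGS]
  exact hpow a₁ θ₁ u₁ ha₁ hθ₁ hu₁ hguard hσ0 hσ N S

/-! ### L1 — extensive transfer along the flow -/

/-- **L1 — EXTENSIVE TRANSFER ALONG THE FLOW** (verbatim the typed statement
`VirginFront.ExtensiveTransferAlongFlow` of `Cruxes/LightConeInLaw/IdeatorFourSketch.lean`, crux-ideate r2 k4
of stmt-AtomisticToContinuum-12500; a lean-on of the r2 crux cards `virgin-front-energy-budget` and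
`clean-territory-island`). For every guard level `M` and homogeneous reference `(a, 0, θ)` there is an
entropy-type density `h ≥ 0` such that, for all continuous profiles obeying the consumer's guards
(`M⁻¹ ≤ a₁ ≤ M`, `M⁻¹ ≤ θ₁ ≤ M`, `‖u₁‖ ≤ M`), all `0 < σ < σ₀ = 1/2`, all hard-sphere flows, every
`K > h` and every family of measurable equilibrium events `A_N` with `G_N(A_N) ≤ e^{-K(N+1)}`, the TRUE
(non-equilibrium) law at ARBITRARY times `s_N` gives `A_N` probability `→ 0`.
Proof: by `lawAt_pow_le_exp_mul_gibbs`,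
`P_{s_N}(A_N)^n ≤ e^{h(N+1)} G_N(A_N) ≤ e^{(h−K)(N+1)} = (e^{-(K−h)(N+1)/n})^n`, hence
`P_{s_N}(A_N) ≤ e^{-(K−h)(N+1)/n} → 0`. No entropy inequality and no law of large numbers is used;
the statement carries no locality (consistent with Disproof §5: it holds for every diameter).
[cite: KipnisLandim1999, App. 1 §8] -/
theorem extensiveTransferAlongFlow :
    ∀ M : ℝ, 0 < M → ∀ (a θ : ℝ), 0 < a → 0 < θ → ∃ h : ℝ, 0 ≤ h ∧
    ∀ (a₁ θ₁ : T3 → ℝ) (u₁ : T3 → V3), Continuous a₁ → Continuous θ₁ → Continuous u₁ →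
      (∀ x, M⁻¹ ≤ a₁ x ∧ a₁ x ≤ M ∧ M⁻¹ ≤ θ₁ x ∧ θ₁ x ≤ M ∧ ‖u₁ x‖ ≤ M) →
    ∃ σ₀ : ℝ, 0 < σ₀ ∧ ∀ σ : ℝ, 0 < σ → σ < σ₀ →
    ∀ Φ : (N : ℕ) → HardSphereFlow (Torus.geometry (Fin 3)) (hsDiameter σ N) (N + 1),
    ∀ K : ℝ, h < K → ∀ A : (N : ℕ) → Set (Config (N + 1) (Fin 3) T3), (∀ N, MeasurableSet (A N)) →
      (∀ N, localGibbsLaw σ (fun _ => a) (fun _ => 0) (fun _ => θ) N (Φ N) (A N) ≤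
          ENNReal.ofReal (Real.exp (-(K * ((N : ℝ) + 1))))) →
      ∀ s : ℕ → ℝ,
        Tendsto (fun N => ((Φ N).lawAt (localGibbsLaw σ a₁ u₁ θ₁ N (Φ N)) (s N)) (A N)) atTop (𝓝 0) := by
  intro M hM a θ ha hθ
  obtain ⟨n, h, hn, hh, hpow⟩ := lawAt_pow_le_exp_mul_gibbs hM hθ
  refine ⟨h, hh, ?_⟩
  intro a₁ θ₁ u₁ ha₁ hθ₁ hu₁ hguard
  refine ⟨1 / 2, by norm_num, ?_⟩
  intro σ hσ0 hσ Φ K hK A hAm hGA s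
  have hn0 : (n : ℝ) ≠ 0 := Nat.cast_ne_zero.2 hn.ne'
  set κ : ℝ := (K - h) / n with hκ
  have hκ0 : 0 < κ := div_pos (sub_pos.2 hK) (Nat.cast_pos.2 hn)
  -- the bound at each `N`
  have hb : ∀ N, ((Φ N).lawAt (localGibbsLaw σ a₁ u₁ θ₁ N (Φ N)) (s N)) (A N) ≤
      ENNReal.ofReal (Real.exp (-κ * ((N : ℝ) + 1))) := by
    intro N
    have h2 : ((Φ N).lawAt (localGibbsLaw σ a₁ u₁ θ₁ N (Φ N)) (s N)) (A N) ^ n ≤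
        ENNReal.ofReal (Real.exp (-κ * ((N : ℝ) + 1))) ^ n := by
      calc ((Φ N).lawAt (localGibbsLaw σ a₁ u₁ θ₁ N (Φ N)) (s N)) (A N) ^ n
          ≤ ENNReal.ofReal (Real.exp (h * (N + 1))) *
              localGibbsLaw σ (fun _ => a) (fun _ => 0) (fun _ => θ) N (Φ N) (A N) :=
            hpow a₁ θ₁ u₁ ha₁ hθ₁ hu₁ hguard hσ0 hσ ha.ne' N (Φ N) (s N) (A N) (hAm N)
        _ ≤ ENNReal.ofReal (Real.exp (h * (N + 1))) *
              ENNReal.ofReal (Real.exp (-(K * ((N : ℝ) + 1)))) := by gcongr; exact hGA N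
        _ = ENNReal.ofReal (Real.exp (-κ * ((N : ℝ) + 1))) ^ n := by
            rw [← ENNReal.ofReal_mul (Real.exp_nonneg _), ← Real.exp_add,
              ← ENNReal.ofReal_pow (Real.exp_nonneg _), ← Real.exp_nat_mul]
            congr 2
            rw [hκ]
            field_simp
            ring
    exact (ENNReal.pow_le_pow_left_iff hn.ne').1 h2
  -- squeeze
  have hlim : Tendsto (fun N : ℕ => ENNReal.ofReal (Real.exp (-κ * ((N : ℝ) + 1)))) atTop (𝓝 0) := by
    have hreal : Tendsto (fun N : ℕ => Real.exp (-κ * ((N : ℝ) + 1))) atTop (𝓝 0) := by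
      refine Real.tendsto_exp_atBot.comp ?_
      have h1 : Tendsto (fun N : ℕ => ((N : ℝ) + 1)) atTop atTop :=
        tendsto_atTop_add_const_right _ 1 tendsto_natCast_atTop_atTop
      exact h1.const_mul_atTop_of_neg (neg_neg_of_pos hκ0)
    simpa using ENNReal.tendsto_ofReal hreal
  exact tendsto_of_tendsto_of_tendsto_of_le_of_le tendsto_const_nhds hlim (fun N => bot_le) hb

end LightConeInLawTransfer

end Summit.AtomisticToContinuum.HydrodynamicLimit.Theorems

end
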